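import Literature.NumberTheory.NumberFields.HilbertClassFieldMaximal
import Literature.NumberTheory.NumberFields.UnramifiedCompositum
import Literature.NumberTheory.GaloisRepresentations.GlobalArtinMapOfCharactersProofs
import Literature.NumberTheory.GaloisRepresentations.ArtinRestriction
import HarnessLib

/-!
# Route `PrintCFram`, crux C2 `BottomClassIndexLawFiveLe` (stmt-BirchSwinnertonDyer-20372), line
# `eisenstein-resource-bdp-line` (LEAD g9, Road C «conjugation swap», stub O): AN EVERYWHERE-UNRAMIFIED CHARACTER
# OF `Γ_K` FACTORS THROUGH THE CLASS GROUP (Hilbert class field + Artin isomorphism, from the tree's proved CFT)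
# (cell `bsd-print-cfram`, seat `bsd-line-cfram-p1-w6` g0; helper `--supports` 20372; 0 facts, 0 defs)

HONEST FRAMING. Nothing about BSD is proved here; no summit statement is proved by this seat. Stub O of LEAD g9's Road C
("OddVanishQ ⟸ Mazur–Wiles") says: an everywhere-unramified continuous `𝔽_p`-valued character of `Γ_L`, isotypic for an odd
character of `Gal(L/ℚ)`, vanishes. The class-group input (Mazur–Wiles) is in the tree (`…HerbrandOddClassGroup*`); this file is
the CLASS FIELD THEORY step, generic in the number field `K` and the finite abelian target `A`:
**a continuous homomorphism `κ : Γ_K → A` (open kernel) which kills every inertia group `I_𝔓 ≤ Γ_K` (`𝔓` a prime of `ℤ̄_K`)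
and every complex conjugation factors through `Gal(H/K)` — `H` the Hilbert class field — hence through the class group**:
`κ(τ) = g(artinEquiv⁻¹(τ|_H))` for a unique `g : Cl(𝓞 K) →* A` (`exists_factor_classGroup_of_unramified`); in particular
`κ(Frob_𝔓) = g([v])` for `𝔓 ∣ v` (`…_apply_of_isArithFrobAt`). Proof, entirely on the tree's PROVED class field theory:
`M = K̄^{ker κ}` is a finite abelian extension (`ArtinRestriction`: open subgroups ↔ finite subextensions), unramified at every
finite prime (`isUnramifiedIn_iff_forall_inertia_absRestrictNormalHom_eq_one`) and at the infinite places
(`isUnramifiedAtInfinitePlaces_of_forall_isComplexConjugationAt`), so `M ≤ H` (`le_hilbertClassField`, Cox Thm. 8.10), so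
`ker(Γ_K → Gal(H/K)) ≤ ker κ` and `κ` descends (Mathlib `MonoidHom.liftOfSurjective`); `artinEquiv : Cl(𝓞 K) ≃* Gal(H/K)` and
`absRestrictNormalHom_eq_artinEquiv_mk0` (Frobenius ↦ class) finish. For an ODD-order target the complex-conjugation hypothesis
is free (`apply_eq_one_of_isComplexConjugationAt_of_odd`, `c² = 1`).

THEOREMS ONLY; no definition, no named fact, no `sorry`; imports no `Theses` module.
References: [Cox2013] §5.A, §8.A Thm. 8.10; [NeukirchANT1999] Ch. VI §6 (6.9), §7 (7.1).
-/

set_option autoImplicit false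
-- `…BirchSwinnertonDyer.BirchSwinnertonDyer.Theorems…` is the problem's mandated namespace (D-0017).
set_option linter.dupNamespace false

noncomputable section

open NumberField Field IsDedekindDomain
open Literature.NumberTheory.GaloisRepresentations Literature.NumberTheory.NumberFields
open scoped IsMulCommutative

namespace Summit.BirchSwinnertonDyer.BirchSwinnertonDyer.Theorems.PrintCFram.HerbrandOddClassGroup

variable (K : Type) [Field K] [NumberField K] {A : Type*} [CommGroup A]

omit [NumberField K] in
/-- For a target of ODD order, a complex conjugation `c` (`c² = 1`) is killed by every `κ : Γ_K → A`. [folklore] -/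
theorem apply_eq_one_of_isComplexConjugationAt_of_odd [Finite A] (hA : Odd (Nat.card A))
    (κ : absoluteGaloisGroup K →* A) {w : InfinitePlace K} (hw : w.IsReal) {c : absoluteGaloisGroup K}
    (hc : IsComplexConjugationAt hw c) : κ c = 1 := by
  have h2 : (κ c) ^ 2 = 1 := by rw [← map_pow, IsComplexConjugation.sq_eq_one hc, map_one]
  have hd2 : orderOf (κ c) ∣ 2 := orderOf_dvd_of_pow_eq_one h2
  have hdA : orderOf (κ c) ∣ Nat.card A := orderOf_dvd_natCard (κ c)
  have h1 : orderOf (κ c) = 1 := by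
    have hcop : Nat.Coprime 2 (Nat.card A) := (Nat.coprime_two_left).mpr hA
    exact Nat.eq_one_of_dvd_coprimes hcop hd2 hdA
  exact orderOf_eq_one_iff.mp h1

/-- **An everywhere-unramified continuous character of `Γ_K` factors through `Gal(H/K)`, `H` the Hilbert class field.**
`κ : Γ_K → A` (abelian `A`) with OPEN kernel, killing every inertia group `I_𝔓` (`𝔓` a prime of `ℤ̄_K` above a finite
place `v`) and every complex conjugation at a real place: `κ = g ∘ (Γ_K → Gal(H/K))` for some `g`.
[cite: Cox2013, §8.A Thm. 8.10 (the Hilbert class field is the maximal unramified abelian extension)]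
[cite: NeukirchANT1999, Ch. VI §6 Prop. (6.9)] -/
theorem exists_factor_galHilbertClassField_of_unramified (κ : absoluteGaloisGroup K →* A)
    (hκ : IsOpen (κ.ker : Set (absoluteGaloisGroup K)))
    (hunr : ∀ (v : HeightOneSpectrum (𝓞 K)) (𝔓 : Ideal (absIntegers (𝓞 K) K)), 𝔓 ∈ v.primesAbove →
      ∀ g ∈ 𝔓.inertia (absoluteGaloisGroup K), κ g = 1)
    (hconj : ∀ (w : InfinitePlace K) (hw : w.IsReal) (c : absoluteGaloisGroup K),
      IsComplexConjugationAt hw c → κ c = 1) :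
    ∃ g : (hilbertClassField K ≃ₐ[K] hilbertClassField K) →* A,
      ∀ τ : absoluteGaloisGroup K, κ τ = g (absRestrictNormalHom (hilbertClassField K) τ) := by
  classical
  -- the fixed field of `ker κ`
  set M : IntermediateField K (AlgebraicClosure K) := IntermediateField.fixedField κ.ker with hMdef
  have hfix : M.fixingSubgroup = κ.ker := fixingSubgroup_fixedField_of_isOpen κ.ker hκ
  haveI : FiniteDimensional K M := finiteDimensional_fixedField_of_isOpen κ.ker hκ
  haveI : NumberField M := NumberField.of_module_finite K M
  -- `M/K` is Galois (the kernel is normal) and abelian (the target is)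
  haveI : IsGalois K M := by
    rw [← InfiniteGalois.normal_iff_isGalois, hfix]
    exact MonoidHom.normal_ker κ
  have hres1 : ∀ γ : absoluteGaloisGroup K, absRestrictNormalHom M γ = 1 ↔ κ γ = 1 := fun γ => by
    rw [absRestrictNormalHom_eq_one_iff, ← MonoidHom.mem_ker, ← hfix]
    rfl
  haveI : IsAbelianGalois K M :=
    { is_comm := ⟨fun a b => by
        obtain ⟨α, rfl⟩ := absRestrictNormalHom_surjective M a
        obtain ⟨β, rfl⟩ := absRestrictNormalHom_surjective M b
        have hγ : κ (α * β * (β * α)⁻¹) = 1 := by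
          rw [map_mul, map_inv, map_mul, map_mul, mul_comm (κ β) (κ α), mul_inv_cancel]
        have h := (hres1 _).mpr hγ
        rwa [map_mul, map_inv, mul_inv_eq_one, map_mul, map_mul] at h⟩ }
  -- unramified at the finite primes and at infinity
  have hunrM : ∀ v : HeightOneSpectrum (𝓞 K), Algebra.IsUnramifiedIn (𝓞 M) v.asIdeal := fun v =>
    (isUnramifiedIn_iff_forall_inertia_absRestrictNormalHom_eq_one M v).mpr fun 𝔓 h𝔓 g hg =>
      (hres1 g).mpr (hunr v 𝔓 h𝔓 g hg)
  haveI : IsUnramifiedAtInfinitePlaces K M :=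
    isUnramifiedAtInfinitePlaces_of_forall_isComplexConjugationAt M fun w hw c hc =>
      (hres1 c).mpr (hconj w hw c hc)
  -- so `M ≤ H`, and `ker (Γ_K → Gal(H/K)) ≤ ker κ`
  have hle : M ≤ hilbertClassField K := hilbertClassField.le_hilbertClassField K M hunrM
  have hker : (absRestrictNormalHom (hilbertClassField K)).ker ≤ κ.ker := by
    intro γ hγ
    have h1 := ker_absRestrictNormalHom_le M hle hγ
    rw [MonoidHom.mem_ker] at h1 ⊢
    exact (hres1 γ).mp h1
  have hsurj := absRestrictNormalHom_surjective (hilbertClassField K)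
  refine ⟨(absRestrictNormalHom (hilbertClassField K)).liftOfRightInverse (Function.surjInv hsurj)
    (Function.rightInverse_surjInv hsurj) ⟨κ, hker⟩, fun τ => ?_⟩
  exact ((absRestrictNormalHom (hilbertClassField K)).liftOfRightInverse_comp_apply (Function.surjInv hsurj)
    (Function.rightInverse_surjInv hsurj) ⟨κ, hker⟩ τ).symm

/-- **…hence through the class group**: `κ(τ) = g(artinEquiv⁻¹(τ|_H))` for some `g : Cl(𝓞 K) →* A` (Artin isomorphism
`Cl(𝓞 K) ≅ Gal(H/K)` of the tree). [cite: NeukirchANT1999, Ch. VI §6 Prop. (6.9), §7 Thm. (7.1)] [cite: Cox2013, §8.A Thm. 8.10] -/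
theorem exists_factor_classGroup_of_unramified (κ : absoluteGaloisGroup K →* A)
    (hκ : IsOpen (κ.ker : Set (absoluteGaloisGroup K)))
    (hunr : ∀ (v : HeightOneSpectrum (𝓞 K)) (𝔓 : Ideal (absIntegers (𝓞 K) K)), 𝔓 ∈ v.primesAbove →
      ∀ g ∈ 𝔓.inertia (absoluteGaloisGroup K), κ g = 1)
    (hconj : ∀ (w : InfinitePlace K) (hw : w.IsReal) (c : absoluteGaloisGroup K),
      IsComplexConjugationAt hw c → κ c = 1) :
    ∃ g : ClassGroup (𝓞 K) →* A, ∀ τ : absoluteGaloisGroup K,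
      κ τ = g ((hilbertClassField.artinEquiv K).symm (absRestrictNormalHom (hilbertClassField K) τ)) := by
  obtain ⟨g₀, hg₀⟩ := exists_factor_galHilbertClassField_of_unramified K κ hκ hunr hconj
  refine ⟨g₀.comp (hilbertClassField.artinEquiv K).toMonoidHom, fun τ => ?_⟩
  rw [MonoidHom.comp_apply, MulEquiv.coe_toMonoidHom, MulEquiv.apply_symm_apply]
  exact hg₀ τ

/-- **Frobenius reading**: with `g` as above, `κ(σ) = g([v])` for every arithmetic Frobenius `σ` at a prime `𝔓 ∣ v` of `ℤ̄_K`
(`[v]` the class of the prime `v`). [cite: NeukirchANT1999, Ch. VI §7 Thm. (7.1)] -/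
theorem apply_eq_classGroup_mk0_of_isArithFrobAt {κ : absoluteGaloisGroup K →* A} {g : ClassGroup (𝓞 K) →* A}
    (hg : ∀ τ : absoluteGaloisGroup K,
      κ τ = g ((hilbertClassField.artinEquiv K).symm (absRestrictNormalHom (hilbertClassField K) τ)))
    {v : HeightOneSpectrum (𝓞 K)} {𝔓 : Ideal (absIntegers (𝓞 K) K)} (h𝔓 : 𝔓 ∈ v.primesAbove)
    {σ : absoluteGaloisGroup K} (hσ : IsArithFrobAt (𝓞 K) σ 𝔓) :
    κ σ = g (ClassGroup.mk0 ⟨v.asIdeal, asIdeal_mem_nonZeroDivisors v⟩) := by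
  rw [hg σ, hilbertClassField.absRestrictNormalHom_eq_artinEquiv_mk0 K h𝔓 hσ, MulEquiv.symm_apply_apply]

/-- The ODD-order packaging used by stub O (`A` finite of odd order, e.g. `Multiplicative (ZMod p)` for `p` odd): the
complex-conjugation hypothesis is automatic. [cite: Cox2013, §8.A Thm. 8.10] -/
theorem exists_factor_classGroup_of_unramified_of_odd [Finite A] (hA : Odd (Nat.card A))
    (κ : absoluteGaloisGroup K →* A) (hκ : IsOpen (κ.ker : Set (absoluteGaloisGroup K)))
    (hunr : ∀ (v : HeightOneSpectrum (𝓞 K)) (𝔓 : Ideal (absIntegers (𝓞 K) K)), 𝔓 ∈ v.primesAbove →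
      ∀ g ∈ 𝔓.inertia (absoluteGaloisGroup K), κ g = 1) :
    ∃ g : ClassGroup (𝓞 K) →* A, ∀ τ : absoluteGaloisGroup K,
      κ τ = g ((hilbertClassField.artinEquiv K).symm (absRestrictNormalHom (hilbertClassField K) τ)) :=
  exists_factor_classGroup_of_unramified K κ hκ hunr fun _ hw _ hc =>
    apply_eq_one_of_isComplexConjugationAt_of_odd K hA κ hw hc

end Summit.BirchSwinnertonDyer.BirchSwinnertonDyer.Theorems.PrintCFram.HerbrandOddClassGroup

end
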